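import Literature.AlgebraicGeometry.Frobenioids.PadicFrobenioidInclusion
import Literature.AlgebraicGeometry.Frobenioids.PadicFrobenioidPrimitiveSplit
import Literature.AlgebraicGeometry.Frobenioids.PadicFrobenioidPerfectionMonoid
import HarnessLib

/-!
# Frobenioids II, Example 1.1 (ii) ⇝ [IUTchI] Example 3.3 (i): the L1-side export `(C_v, Φ_{C_v}, C_v^⊢, Φ_{C_v^⊢}, τ_v^⊢, C_v^⊢ → C_v)`

Mochizuki, *The geometry of Frobenioids II*, Kyushu J. Math. **62** (2008) 401–460, §1, Example 1.1 (ii), p. 8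
[cite: MochizukiFrdII2008, Ex 1.1 (ii) p.8]; consumed by [IUTchI] Ex. 3.3 (i): "these monoids `Φ_{C_v^⊢}`, `Φ_{C_v}`
determine `p_v`-adic Frobenioids `C_v^⊢ ⊆ C_v` [cf. [FrdII], Example 1.1, (ii), where we take 'Λ' to be `ℤ`],
whose base categories are given by `D_v^⊢`, `D_v` [in a fashion compatible with the natural inclusion
`D_v^⊢ ⊆ D_v`], respectively."

* `Datum.logp`, `Datum.prim_logp_generates` — `Φ^⊢(A) = ℤ_{≥0} · ord(p)` is free on `log(p) := ord(p) ⊗ 1`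
  ("write `log(p_v)` for the element `p_v` of (i) considered additively", [IUTchI] Ex. 3.3 (ii));
  `Datum.primToPerf_η_injective`; `Datum.primToPerfFunctor_comp_baseFunctor` (`C^⊢ → C → D` is `C^⊢ → D`).

abc-iut-L1-lead R52 (5a): an L1-side EXPORT (no L5 file touched) of the honest objects of this directory in the
FIELD NAMES of abc-iut-L5-t2's interface `GoodLocalFrobenioid` (`Literature/IUT/HodgeTheaters/SplitFrobenioids.lean`),
over ONE base `D` of `p`-adic local fields (read: `D_v^⊢`; `Datum.perf (proj ⋙ base)` gives `C_v` over `D_v`):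
`GoodLocalKit.PhiC/Cv/toBase/PhiCdash/Cdash/CdashBase/PhiIncl/PhiIncl_injective/logp/logp_generates/CdashToC/
CdashToC_faithful/CdashToC_base/p_mem/tauDash` (+ `isAbsolutelyPrimitive`, `isMonoidData`). The `tauDash` slot is
abc-iut-L1-t2's `PreFrobenioid.CharacteristicSplitting` (the adapter to L5's `S3Local.CharSplitting` is L5's).

General brick (not in the tree before): `ModelFrobenioid.baseChange G` — for a functor of bases `G : D' ⥤ D` the
functor from the model Frobenioid of the pulled-back data `(G^op ⋙ Φ, G^op ⋙ B, Div_B|_{D'})` over `D'` to the model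
Frobenioid of `(Φ, B, Div_B)` over `D`, `(A', α) ↦ (G A', α)` (the identity on fibres) — the piece needed to place
`C_v^⊢` (over `D_v^⊢`) inside `C_v` (over `D_v`) along `D_v^⊢ ⊆ D_v`; here `GoodLocalKit.baseChangeCv`.
-/

noncomputable section

namespace Literature.AlgebraicGeometry.Frobenioids

open CategoryTheory Opposite Function

/-! ### Base change of model Frobenioids along a functor of bases -/

namespace ModelFrobenioid

universe w v v' u u'

variable {D : Type u} [Category.{v} D] {D' : Type u'} [Category.{v'} D'] (G : D' ⥤ D)
  (Φ B : Dᵒᵖ ⥤ CommMonCat.{w}) (DivB : B ⟶ monoidGp Φ)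

/-- `Div_B` restricted to `D'` along `G`: `G^op ⋙ B ⟶ (G^op ⋙ Φ)^gp`. [cite: MochizukiFrdI2008, Thm. 5.2(i) p.100] -/
abbrev divBRestrict : G.op ⋙ B ⟶ monoidGp (G.op ⋙ Φ) := Functor.whiskerLeft G.op DivB

/-- **Base change along `G : D' ⥤ D`**: the functor from the model Frobenioid of the restricted data
`(Φ|_{D'}, B|_{D'}, Div_B|_{D'})` over `D'` to the model Frobenioid of `(Φ, B, Div_B)` over `D`, `(A', α) ↦ (G A', α)`,
`(d, f, Div, u) ↦ (d, G f, Div, u)` (the identity on the fibre data; Thm. 5.2 (i)'s formulas are preserved because the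
pull-back maps of the restricted data ARE those of `Φ`, `B` along `G f`). [cite: MochizukiFrdI2008, Thm. 5.2(i) p.100] -/
def baseChange : ModelFrobenioid (G.op ⋙ Φ) (G.op ⋙ B) (divBRestrict G Φ B DivB) ⥤ ModelFrobenioid Φ B DivB where
  obj X := ⟨G.obj X.base, X.cls⟩
  map {X Y} φ :=
    { degFr := Hom.degFr (X := X) (Y := Y) φ
      base := G.map (Hom.base (X := X) (Y := Y) φ)
      div := Hom.div (X := X) (Y := Y) φ
      unit := Hom.unit (X := X) (Y := Y) φ
      rel := Hom.rel (X := X) (Y := Y) φ }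
  map_id X := by
    apply hom_ext
    · rfl
    · exact G.map_id _
    · rfl
    · rfl
  map_comp {X Y Z} φ ψ := by
    apply hom_ext
    · rfl
    · exact G.map_comp _ _
    · rfl
    · rfl

/-- Base change commutes with the projections to the bases: `baseChange ⋙ (→ D) = (→ D') ⋙ G`.
[cite: MochizukiFrdI2008, Thm. 5.2(i) p.100] -/
theorem baseChange_comp_baseFunctor :
    baseChange G Φ B DivB ⋙ baseFunctor Φ B DivB = baseFunctor _ _ (divBRestrict G Φ B DivB) ⋙ G := rfl

/-- Base change is faithful when `G` is. [cite: MochizukiFrdI2008, Thm. 5.2(i) p.100] -/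
theorem baseChange_faithful [G.Faithful] : (baseChange G Φ B DivB).Faithful := by
  refine ⟨fun {X Y} φ ψ h => ?_⟩
  let F := baseChange G Φ B DivB
  apply hom_ext
  · exact congrArg (fun χ : F.obj X ⟶ F.obj Y => Hom.degFr χ) h
  · exact G.map_injective (congrArg (fun χ : F.obj X ⟶ F.obj Y => Hom.base χ) h)
  · exact congrArg (fun χ : F.obj X ⟶ F.obj Y => Hom.div χ) h
  · exact congrArg (fun χ : F.obj X ⟶ F.obj Y => Hom.unit χ) h

end ModelFrobenioid

/-! ### Restriction of a subfunctor datum along a functor of bases (`Φ_{C_v}` "by pull-back via `D_v → D_v^⊢`") -/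

namespace PadicFrd.SubDatum

universe v₁ v₂ u₁

variable {D : Type u₁} [Category.{v₁} D] {Dv : Type u₁} [Category.{v₂} Dv] {p : ℕ} {base : D ⥤ PadicFld.{u₁} p}
  (T : SubDatum base) (proj : Dv ⥤ D)

/-- The subfunctor datum pulled back along `proj : D_v → D_v^⊢` ("hence, by pull-back via the natural functor
`D_v → D_v^⊢`, on `D_v`", [IUTchI] Ex. 3.3 (i)): same submonoids, over the composite base functor.
[cite: MochizukiFrdII2008, Ex 1.1 (ii) p.8] -/
def restrict : SubDatum (proj ⋙ base) where
  S A := T.S (proj.obj A)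
  map_mem f x hx := T.map_mem (proj.map f.unop).op x hx
  isMonoprime _ := T.isMonoprime _
  g _ := T.g _
  g_mem _ := T.g_mem _
  g_not_isUnit _ := T.g_not_isUnit _

/-- The divisor monoid of the restricted datum IS the pull-back `proj^op ⋙ Φ` (definitionally).
[cite: MochizukiFrdII2008, Ex 1.1 (ii) p.8] -/
theorem restrict_Φ : (T.restrict proj).Φ = proj.op ⋙ T.Φ := rfl

/-- … and likewise for `B`. [cite: MochizukiFrdII2008, Ex 1.1 (ii) p.8] -/
theorem restrict_B : (T.restrict proj).B = proj.op ⋙ T.B := rfl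

end PadicFrd.SubDatum

/-! ### `Φ_{C^⊢}` is free on `log(p)`; `C^⊢ → C` lies over the base -/

namespace PadicFrd

universe v₀ u₀

variable {D : Type u₀} [Category.{v₀} D] {p : ℕ} [Fact p.Prime] (base : D ⥤ PadicFld.{u₀} p)
  (hloc : ∀ A : D, (base.obj A).IsPadicLocal) (hc : IsConnected D) (he : IsTotallyEpimorphic D)

namespace Datum

/-- **`log(p)`**: the generator `ord(p) ⊗ 1` of `Φ^⊢(A)` as an element of the divisor monoid of `C^⊢`
("write `log(p_v)` for the element `p_v` … considered additively", [IUTchI] Ex. 3.3 (ii)). [cite: MochizukiFrdII2008, Ex 1.1 (ii) p.8] -/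
def logp (A : Dᵒᵖ) : (Datum.prim base hloc hc he).Φ.obj A := ⟨primGen base A.unop, Submonoid.mem_powers _⟩

/-- **`Φ^⊢(A)` is free on `log(p)`**: every element is `log(p)^n` for a unique `n ∈ ℕ` ("`ord(ℤ_{p_v}^⊳)`" `≅ ℕ`).
[cite: MochizukiFrdII2008, Ex 1.1 (ii) p.8] -/
theorem prim_logp_generates (A : Dᵒᵖ) (x : (Datum.prim base hloc hc he).Φ.obj A) :
    ∃! n : ℕ, x = logp base hloc hc he A ^ n := by
  obtain ⟨y, n, rfl⟩ := x
  refine ⟨n, Subtype.ext rfl, fun m hm => ?_⟩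
  have h : primGen base A.unop ^ n = primGen base A.unop ^ m := congrArg Subtype.val hm
  exact (primGen_pow_injective base (hloc A.unop) h).symm

/-- The inclusion `Φ^⊢ ↪ ord(O^⊳)^pf` underlying `C^⊢ → C` is objectwise injective.
[cite: MochizukiFrdII2008, Ex 1.1 (ii) p.8] -/
theorem primToPerf_η_injective (A : Dᵒᵖ) : Injective ((Datum.primToPerf base hloc hc he).η.app A).hom := by
  intro x y h
  have h' := congrArg Subtype.val h
  exact Subtype.ext h'

/-- `C^⊢ → C` lies over the identity of the base: `(C^⊢ ⥤ C) ⋙ (C → D) = (C^⊢ → D)`.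
[cite: MochizukiFrdII2008, Ex 1.1 (ii) p.8] -/
theorem primToPerfFunctor_comp_baseFunctor :
    Datum.primToPerfFunctor base hloc hc he ⋙ ModelFrobenioid.baseFunctor _ _ (Datum.perf base hloc hc he).divB =
      ModelFrobenioid.baseFunctor _ _ (Datum.prim base hloc hc he).divB := rfl

/-- … hence also over the identity of `D₀`: `(C^⊢ ⥤ C) ⋙ (C → D₀) = (C^⊢ → D₀)`. [cite: MochizukiFrdII2008, Ex 1.1 (ii) p.8] -/
theorem primToPerfFunctor_comp_toBaseZero :
    Datum.primToPerfFunctor base hloc hc he ⋙ (Datum.perf base hloc hc he).toBaseZero =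
      (Datum.prim base hloc hc he).toBaseZero := rfl

end Datum

end PadicFrd

/-! ### The export -/

namespace PadicFrd

namespace GoodLocalKit

universe v u

variable {D : Type u} [Category.{v} D] {p : ℕ} [Fact p.Prime] (base : D ⥤ PadicFld.{u} p)
  (hloc : ∀ A : D, (base.obj A).IsPadicLocal) (hc : IsConnected D) (he : IsTotallyEpimorphic D)

/-- `Φ_{C_v} : Spec(L) ↦ ord(O_L^⊳)^pf` (the perfection inside `Φ₀`). [cite: MochizukiFrdII2008, Ex 1.1 (ii) p.8] -/
abbrev PhiC : Dᵒᵖ ⥤ CommMonCat.{u} := (Datum.perf base hloc hc he).Φ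

/-- `C_v`, the `p_v`-adic Frobenioid of `Φ_{C_v}` (a model Frobenioid). [cite: MochizukiFrdII2008, Ex 1.1 (ii) p.8] -/
abbrev Cv : Type u := (Datum.perf base hloc hc he).frobenioid

/-- `C_v → D` (base category). [cite: MochizukiFrdII2008, Ex 1.1 (ii) p.8] -/
abbrev toBase : Cv base hloc hc he ⥤ D := ModelFrobenioid.baseFunctor _ _ (Datum.perf base hloc hc he).divB

/-- `Φ_{C_v^⊢} : Spec(L) ↦ ord(ℤ_{p_v}^⊳)` (`= ℤ_{≥0} · ord(p)`). [cite: MochizukiFrdII2008, Ex 1.1 (ii) p.8] -/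
abbrev PhiCdash : Dᵒᵖ ⥤ CommMonCat.{u} := (Datum.prim base hloc hc he).Φ

/-- `C_v^⊢`, the absolutely primitive `p_v`-adic Frobenioid. [cite: MochizukiFrdII2008, Ex 1.1 (ii) p.8] -/
abbrev Cdash : Type u := (Datum.prim base hloc hc he).frobenioid

/-- `C_v^⊢ → D` (base category). [cite: MochizukiFrdII2008, Ex 1.1 (ii) p.8] -/
abbrev CdashBase : Cdash base hloc hc he ⥤ D := ModelFrobenioid.baseFunctor _ _ (Datum.prim base hloc hc he).divB

/-- The inclusion `Φ_{C_v^⊢} ⊆ Φ_{C_v}`. [cite: MochizukiFrdII2008, Ex 1.1 (ii) p.8] -/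
abbrev PhiIncl : PhiCdash base hloc hc he ⟶ PhiC base hloc hc he := (Datum.primToPerf base hloc hc he).η

/-- The inclusion `Φ_{C_v^⊢} ⊆ Φ_{C_v}` is objectwise injective. [cite: MochizukiFrdII2008, Ex 1.1 (ii) p.8] -/
theorem PhiIncl_injective (A : Dᵒᵖ) : Injective ((PhiIncl base hloc hc he).app A).hom :=
  Datum.primToPerf_η_injective base hloc hc he A

/-- `log(p_v)`, the generator of `Φ_{C_v^⊢}(A)`. [cite: MochizukiFrdII2008, Ex 1.1 (ii) p.8] -/
abbrev logp (A : Dᵒᵖ) : (PhiCdash base hloc hc he).obj A := Datum.logp base hloc hc he A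

/-- `Φ_{C_v^⊢}(A)` is free on `log(p_v)`. [cite: MochizukiFrdII2008, Ex 1.1 (ii) p.8] -/
theorem logp_generates (A : Dᵒᵖ) (x : (PhiCdash base hloc hc he).obj A) : ∃! n : ℕ, x = logp base hloc hc he A ^ n :=
  Datum.prim_logp_generates base hloc hc he A x

/-- `C_v^⊢ ⊆ C_v` (the functor induced by the inclusion of data). [cite: MochizukiFrdII2008, Ex 1.1 (ii) p.8] -/
abbrev CdashToC : Cdash base hloc hc he ⥤ Cv base hloc hc he := Datum.primToPerfFunctor base hloc hc he

/-- `C_v^⊢ ⊆ C_v` is faithful. [cite: MochizukiFrdII2008, Ex 1.1 (ii) p.8] -/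
theorem CdashToC_faithful : (CdashToC base hloc hc he).Faithful := Datum.primToPerfFunctor_faithful base hloc hc he

/-- `C_v^⊢ ⊆ C_v` lies over the (identity of the) base. [cite: MochizukiFrdII2008, Ex 1.1 (ii) p.8] -/
def CdashToC_base : CdashToC base hloc hc he ⋙ toBase base hloc hc he ≅ CdashBase base hloc hc he :=
  eqToIso (Datum.primToPerfFunctor_comp_baseFunctor base hloc hc he)

omit [Fact p.Prime] in
/-- `p_v ∈ ℤ_{p_v}^⊳ ⊆ O_{K_A}^⊳` for every base object `A`. [cite: MochizukiFrdII2008, Ex 1.1 (ii) p.8] -/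
theorem p_mem (A : D) : ((p : ℕ) : (base.obj A).K) ∈ intNonzero (base.obj A).K := (base.obj A).p_mem

/-- `τ_v^⊢`: the characteristic splitting on `C_v^⊢` determined by `p_v` ([FrdII] Thm. 1.2 (v); [FrdI] Def. 2.3 as
typed by abc-iut-L1-t2). [cite: MochizukiFrdII2008, Thm 1.2 (v) p.9] -/
abbrev tauDash : PreFrobenioid.CharacteristicSplitting (Datum.prim base hloc hc he).structureFunctor :=
  Datum.primSplitting base hloc hc he

/-- `Φ_{C_v^⊢}` is absolutely primitive. [cite: MochizukiFrdII2008, Ex 1.1 (ii) p.8] -/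
theorem isAbsolutelyPrimitive : (Datum.prim base hloc hc he).IsAbsolutelyPrimitive :=
  Datum.prim_isAbsolutelyPrimitive base hloc hc he

/-- Over a base of FSM-type, "`Φ`, `B` are monoids on `D`" for both `C_v^⊢` and `C_v`.
[cite: MochizukiFrdII2008, Ex 1.1 (ii) p.8] -/
theorem isMonoidData (hD : IsOfFSMType D) :
    (Datum.prim base hloc hc he).IsMonoidData ∧ (Datum.perf base hloc hc he).IsMonoidData :=
  ⟨Datum.prim_isMonoidData base hloc hc he hD, Datum.perf_isMonoidData base hloc hc he hD⟩

/-! ### Two bases: `C_v` over `D_v` from `proj : D_v → D_v^⊢`, and `C_v^⊢ → C_v` along `incl : D_v^⊢ → D_v` -/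

universe v' u'

variable {Dv : Type u} [Category.{v'} Dv] (proj : Dv ⥤ D)
  (hlocv : ∀ A : Dv, ((proj ⋙ base).obj A).IsPadicLocal) (hcv : IsConnected Dv) (hev : IsTotallyEpimorphic Dv)

/-- `C_v` over `D_v`: the `p_v`-adic Frobenioid of `Φ_{C_v}` pulled back along `proj : D_v → D_v^⊢` ("hence, by
pull-back via the natural functor `D_v → D_v^⊢`, on `D_v`", [IUTchI] Ex. 3.3 (i)). [cite: MochizukiFrdII2008, Ex 1.1 (ii) p.8] -/
abbrev CvOver : Type u := (Datum.perf (proj ⋙ base) hlocv hcv hev).frobenioid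

/-- `C_v` over `D_v` is the `p_v`-adic Frobenioid of the perfection datum RESTRICTED along `proj` (definitionally),
so that its data are `(proj^op ⋙ Φ_{C_v}, proj^op ⋙ B)` (`SubDatum.restrict_Φ/_B`). [cite: MochizukiFrdII2008, Ex 1.1 (ii) p.8] -/
theorem perf_proj_eq_restrict :
    Datum.perf (proj ⋙ base) hlocv hcv hev = ((perfSubDatum base hloc).restrict proj).toDatum hlocv hcv hev := rfl

variable (incl : D ⥤ Dv)

/-- `C_v`'s data restricted back along `incl : D_v^⊢ → D_v`, placed inside `C_v` over `D_v` by base change (the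
identity on fibres; composes with the transport along `proj ∘ incl ≅ 𝟭` and `CdashToC` to give `C_v^⊢ → C_v` across
the two bases — the transport step is left to the merge file). [cite: MochizukiFrdII2008, Ex 1.1 (ii) p.8] -/
abbrev baseChangeCv :
    ModelFrobenioid (incl.op ⋙ (Datum.perf (proj ⋙ base) hlocv hcv hev).Φ) (incl.op ⋙ (Datum.perf (proj ⋙ base) hlocv hcv hev).B)
        (ModelFrobenioid.divBRestrict incl _ _ (Datum.perf (proj ⋙ base) hlocv hcv hev).divB) ⥤
      CvOver base proj hlocv hcv hev :=
  ModelFrobenioid.baseChange incl _ _ _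

end GoodLocalKit

end PadicFrd

end Literature.AlgebraicGeometry.Frobenioids
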